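import Summits.AnomalousDissipation.AnomalousDissipation.Theorems.EnsembleRigidityGPStatisticalRigidityGpSmallEnergy
import Summits.AnomalousDissipation.AnomalousDissipation.Theorems.ImpulseGridGridThesisStubAcdcStrainBound
import Literature.Analysis.FluidPDE.StokesTorusProofs
import Literature.Analysis.FluidPDE.EulerTorusUniqueness
import Literature.Analysis.FunctionSpaces.TorusFluidGlueProofs

/-!
# Crux `NeutralTaylorWaves.NewtonRealisation` (stmt-AnomalousDissipation-16315), negative lane:
# calculus of the axial shear mode (tools for `BorderedBoundShear`, `BorderedBoundInhabited`)

The standing disprover's inhabitant of the crux's bordered `L²` a-priori clause is the axial shear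
state `u₀ = sin(2πx₃) a` (`Torus.stokesMode e₃ a false`, horizontal amplitude `a₃ = 0`) with its
cosine partner `C = cos(2πx₃) a`.  This file collects the pointwise and integral identities the
energy method needs (refuter cdisprove, 2026-08-17): derivatives of the cosine mode
(`partialDeriv_cosMode`, `fderiv_cosMode`; the sine versions are the tree's
`AcdcStrain.partialDeriv_stokesMode_sin`, `gpForce_fderiv_stokesMode_sin`), the pointwise size
`‖stokesMode k a c x‖ ≤ ‖a‖`, the transport facts `(u₀·∇)u₀ = 0`, `(u₀·∇)C = 0`,
`(v·∇)u₀ = (2πv₃) • C`, `∂₃u₀ = 2π • C`, `Δ = −4π²` on the axial modes, the antisymmetry of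
transport `∫⟪(u·∇)p, q⟫ = −∫⟪p, (u·∇)q⟫`, Cauchy–Schwarz for `∫‖a‖‖w‖`, and the six-term splitting
of the pairing of the bordered image `u₀·∇v + v·∇u₀ − νΔv + ∇r − c∂ᵢv − b∂ᵢu₀` with a smooth field.
All from landed tree calculus (`partialDeriv_mFourier`, `fderiv_inner_apply`,
`integral_fderiv_apply_eq_zero_of_isDivFree`, `laplacian_stokesMode`, Hölder). [folklore]
-/

set_option linter.dupNamespace false

noncomputable section

namespace Summit.AnomalousDissipation.AnomalousDissipation.Theorems.NewtonRealisation.Negative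

open MeasureTheory
open scoped InnerProductSpace RealInnerProductSpace
open Literature.Analysis.FluidPDE Literature.Analysis.FluidPDE.Torus
open Literature.Analysis.FunctionSpaces Literature.Analysis.FunctionSpaces.Torus
open Summit.AnomalousDissipation.AnomalousDissipation.Theorems.EnsembleRigidity.GPStatisticalRigidity
  (gpForce_fderiv_stokesMode_sin gpForce_integral_norm_sq_stokesMode)
open Summit.AnomalousDissipation.AnomalousDissipation.Theorems (AcdcStrain.partialDeriv_stokesMode_sin)

/-! ## Mode calculus for the axial frequency `e₃ = Pi.single 2 1` -/

/-- `∂ⱼ (Re e_k • a) = -(2π kⱼ Im e_k) • a`. [folklore] -/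
theorem partialDeriv_cosMode (k : Fin 3 → ℤ) (a : EuclideanSpace ℝ (Fin 3)) (j : Fin 3)
    (x : UnitAddTorus (Fin 3)) :
    partialDeriv j (⇑(stokesMode k a true)) x =
      (-(2 * Real.pi * (k j : ℝ) * (UnitAddTorus.mFourier k x).im)) • a := by
  have e : (⇑(stokesMode k a true) : UnitAddTorus (Fin 3) → EuclideanSpace ℝ (Fin 3)) =
      ⇑(Complex.reCLM.smulRight a) ∘ ⇑(UnitAddTorus.mFourier k) := by
    funext y
    simp [stokesMode_apply]
  rw [e, partialDeriv_clm_comp (isSmooth_mFourier k) _ j x, partialDeriv_mFourier,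
    ContinuousLinearMap.smulRight_apply, Complex.reCLM_apply]
  congr 1
  simp

/-- Same for the cosine mode: `D(Re e₃ • a)(x) h = -(2π h₃ Im e₃(x)) • a`. [folklore] -/
theorem fderiv_cosMode (a : EuclideanSpace ℝ (Fin 3)) (x : UnitAddTorus (Fin 3))
    (h : EuclideanSpace ℝ (Fin 3)) :
    Torus.fderiv (⇑(stokesMode (Pi.single (2 : Fin 3) (1 : ℤ)) a true)) x h =
      (-(2 * Real.pi * h 2 * (UnitAddTorus.mFourier (Pi.single (2 : Fin 3) (1 : ℤ)) x).im)) • a := by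
  have h1 : IsContDiff 1 (⇑(stokesMode (Pi.single (2 : Fin 3) (1 : ℤ)) a true)) :=
    (isSmooth_stokesMode _ _ _).isContDiff (by simp)
  rw [fderiv_apply_eq_sum_partialDeriv h1]
  simp_rw [partialDeriv_cosMode, smul_smul]
  rw [Fin.sum_univ_three]
  simp
  ring_nf

/-- Pointwise size of a Stokes mode: `‖stokesMode k a c x‖ ≤ ‖a‖`. [folklore] -/
theorem norm_stokesMode_le (k : Fin 3 → ℤ) (a : EuclideanSpace ℝ (Fin 3)) (c : Bool)
    (x : UnitAddTorus (Fin 3)) : ‖stokesMode k a c x‖ ≤ ‖a‖ := by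
  have h1 : ‖UnitAddTorus.mFourier k x‖ = 1 := by simp [UnitAddTorus.mFourier]
  rw [stokesMode_apply, norm_smul]
  have hs : ‖(if c then (UnitAddTorus.mFourier k x).re else (UnitAddTorus.mFourier k x).im)‖ ≤ 1 := by
    cases c
    · simpa [h1] using Complex.abs_im_le_norm (UnitAddTorus.mFourier k x)
    · simpa [h1] using Complex.abs_re_le_norm (UnitAddTorus.mFourier k x)
  calc ‖(if c then (UnitAddTorus.mFourier k x).re else (UnitAddTorus.mFourier k x).im)‖ * ‖a‖
      ≤ 1 * ‖a‖ := mul_le_mul_of_nonneg_right hs (norm_nonneg _)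
    _ = ‖a‖ := one_mul _

/-- The axial frequency is nonzero. -/
theorem axial_ne_zero : (Pi.single (2 : Fin 3) (1 : ℤ) : Fin 3 → ℤ) ≠ 0 := by
  intro h
  have := congrFun h 2
  simp at this

/-- `λ_{e₃} = 4π²`. -/
theorem stokesEigenvalue_axial : stokesEigenvalue (Pi.single (2 : Fin 3) (1 : ℤ)) = 4 * Real.pi ^ 2 := by
  simp [stokesEigenvalue, freqNormSq, Fin.sum_univ_three]

/-- An amplitude with vanishing third component is transversal to `e₃`. -/
theorem transversal_of_apply_two {a : EuclideanSpace ℝ (Fin 3)} (ha : a 2 = 0) :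
    ⟪latticeVec (Pi.single (2 : Fin 3) (1 : ℤ)), a⟫_ℝ = 0 := by
  rw [EuclideanSpace.inner_eq_star_dotProduct]
  simp [dotProduct, Fin.sum_univ_three, latticeVec_apply, ha]


/-! ## Generic torus identities -/

section Generic

variable {d : Type*} [Fintype d] [DecidableEq d]
variable {G' : Type*} [NormedAddCommGroup G'] [InnerProductSpace ℝ G']

/-- Antisymmetry of transport: `∫ ⟪(u·∇)p, q⟫ = -∫ ⟪p, (u·∇)q⟫` for smooth divergence-free `u`
and smooth `p, q` (`D⟪p,q⟫[u] = ⟪p, Dq[u]⟫ + ⟪Dp[u], q⟫` integrates to zero). [folklore] -/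
theorem integral_inner_convect_antisymm {u : UnitAddTorus d → EuclideanSpace ℝ d}
    {p q : UnitAddTorus d → G'} (hu : IsSmooth u) (hdiv : IsDivFree u) (hp : IsSmooth p)
    (hq : IsSmooth q) :
    ∫ x, ⟪convect u p x, q x⟫_ℝ = -∫ x, ⟪p x, convect u q x⟫_ℝ := by
  have h0 := integral_fderiv_apply_eq_zero_of_isDivFree hu (hp.inner hq) hdiv
  have hprod : ∀ x, Torus.fderiv (fun y => ⟪p y, q y⟫_ℝ) x (u x) =
      ⟪p x, convect u q x⟫_ℝ + ⟪convect u p x, q x⟫_ℝ := fun x =>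
    fderiv_inner_apply (hp.isContDiff (by simp)) (hq.isContDiff (by simp)) x (u x)
  simp_rw [hprod] at h0
  rw [integral_add (hp.inner (hu.convect hq)).integrable ((hu.convect hp).inner hq).integrable] at h0
  linarith

omit [Fintype d] [DecidableEq d] in
/-- Cauchy–Schwarz for `∫ ‖a‖ ‖w‖`. [folklore] -/
theorem integral_norm_mul_norm_le {α : Type*} [MeasurableSpace α] {μ : Measure α}
    {E : Type*} [NormedAddCommGroup E] {a w : α → E} (ha : MemLp a 2 μ) (hw : MemLp w 2 μ) :
    ∫ x, ‖a x‖ * ‖w x‖ ∂μ ≤ Real.sqrt (∫ x, ‖a x‖ ^ 2 ∂μ) * Real.sqrt (∫ x, ‖w x‖ ^ 2 ∂μ) := by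
  have h2 := integral_mul_le_Lp_mul_Lq_of_nonneg Real.HolderConjugate.two_two
    (ae_of_all _ fun x => norm_nonneg (a x)) (ae_of_all _ fun x => norm_nonneg (w x))
    (by simpa using ha.norm) (by simpa using hw.norm)
  refine h2.trans_eq ?_
  simp only [Real.rpow_two, one_div, Real.sqrt_eq_rpow]

/-- Splitting the pairing of the bordered image with a smooth field into its six terms. [bookkeeping] -/
theorem integral_inner_image_split {w v φ : UnitAddTorus d → EuclideanSpace ℝ d}
    {r : UnitAddTorus d → ℝ} (hw : IsSmooth w) (hv : IsSmooth v) (hr : IsSmooth r)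
    (hφ : IsSmooth φ) (ν c b : ℝ) (i : d) :
    ∫ x, ⟪convect w v x + convect v w x - ν • laplacian v x + Torus.gradient r x -
        c • partialDeriv i v x - b • partialDeriv i w x, φ x⟫_ℝ =
      (∫ x, ⟪convect w v x, φ x⟫_ℝ) + (∫ x, ⟪convect v w x, φ x⟫_ℝ) -
        ν * (∫ x, ⟪laplacian v x, φ x⟫_ℝ) + (∫ x, ⟪Torus.gradient r x, φ x⟫_ℝ) -
        c * (∫ x, ⟪partialDeriv i v x, φ x⟫_ℝ) - b * (∫ x, ⟪partialDeriv i w x, φ x⟫_ℝ) := by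
  have i1 : Integrable (fun x => ⟪convect w v x, φ x⟫_ℝ) volume := ((hw.convect hv).inner hφ).integrable
  have i2 : Integrable (fun x => ⟪convect v w x, φ x⟫_ℝ) volume := ((hv.convect hw).inner hφ).integrable
  have i3 : Integrable (fun x => ν * ⟪laplacian v x, φ x⟫_ℝ) volume :=
    (hv.laplacian.inner hφ).integrable.const_mul ν
  have i4 : Integrable (fun x => ⟪Torus.gradient r x, φ x⟫_ℝ) volume := (hr.gradient.inner hφ).integrable
  have i5 : Integrable (fun x => c * ⟪partialDeriv i v x, φ x⟫_ℝ) volume :=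
    ((hv.partialDeriv i).inner hφ).integrable.const_mul c
  have i6 : Integrable (fun x => b * ⟪partialDeriv i w x, φ x⟫_ℝ) volume :=
    ((hw.partialDeriv i).inner hφ).integrable.const_mul b
  have hpt : ∀ x, ⟪convect w v x + convect v w x - ν • laplacian v x + Torus.gradient r x -
        c • partialDeriv i v x - b • partialDeriv i w x, φ x⟫_ℝ =
      ⟪convect w v x, φ x⟫_ℝ + ⟪convect v w x, φ x⟫_ℝ - ν * ⟪laplacian v x, φ x⟫_ℝ +
        ⟪Torus.gradient r x, φ x⟫_ℝ - c * ⟪partialDeriv i v x, φ x⟫_ℝ -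
        b * ⟪partialDeriv i w x, φ x⟫_ℝ := by
    intro x
    simp only [inner_sub_left, inner_add_left, real_inner_smul_left]
  simp_rw [hpt]
  have j2 : Integrable (fun x => ⟪convect w v x, φ x⟫_ℝ + ⟪convect v w x, φ x⟫_ℝ) volume :=
    i1.add i2
  have j3 : Integrable (fun x => ⟪convect w v x, φ x⟫_ℝ + ⟪convect v w x, φ x⟫_ℝ -
      ν * ⟪laplacian v x, φ x⟫_ℝ) volume := j2.sub i3
  have j4 : Integrable (fun x => ⟪convect w v x, φ x⟫_ℝ + ⟪convect v w x, φ x⟫_ℝ -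
      ν * ⟪laplacian v x, φ x⟫_ℝ + ⟪Torus.gradient r x, φ x⟫_ℝ) volume := j3.add i4
  have j5 : Integrable (fun x => ⟪convect w v x, φ x⟫_ℝ + ⟪convect v w x, φ x⟫_ℝ -
      ν * ⟪laplacian v x, φ x⟫_ℝ + ⟪Torus.gradient r x, φ x⟫_ℝ -
      c * ⟪partialDeriv i v x, φ x⟫_ℝ) volume := j4.sub i5
  rw [integral_sub j5 i6, integral_sub j4 i5, integral_add j3 i4, integral_sub j2 i3,
    integral_add i1 i2, integral_const_mul, integral_const_mul, integral_const_mul]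

end Generic

/-! ## The axial shear mode `u₀ = sin(2πx₃) a` (`a₃ = 0`) and its cosine partner -/

section Shear

variable {a : EuclideanSpace ℝ (Fin 3)}

/-- `(uₐ·∇)` kills every `x₃`-only field when `a₃ = 0`: `(S·∇)S = 0` for the sine mode. -/
theorem convect_sinMode_sinMode (ha : a 2 = 0) (x : UnitAddTorus (Fin 3)) :
    convect (⇑(stokesMode (Pi.single (2 : Fin 3) (1 : ℤ)) a false))
      (⇑(stokesMode (Pi.single (2 : Fin 3) (1 : ℤ)) a false)) x = 0 := by
  rw [Torus.convect, gpForce_fderiv_stokesMode_sin]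
  simp [stokesMode_apply, ha]

/-- `(S·∇)C = 0` for the sine mode `S` and the cosine mode `C` (both with amplitude `a`, `a₃ = 0`). -/
theorem convect_sinMode_cosMode (ha : a 2 = 0) (x : UnitAddTorus (Fin 3)) :
    convect (⇑(stokesMode (Pi.single (2 : Fin 3) (1 : ℤ)) a false))
      (⇑(stokesMode (Pi.single (2 : Fin 3) (1 : ℤ)) a true)) x = 0 := by
  rw [Torus.convect, fderiv_cosMode]
  simp [stokesMode_apply, ha]

/-- `(v·∇)S = (2π v₃) • C` pointwise. -/
theorem convect_left_sinMode (v : UnitAddTorus (Fin 3) → EuclideanSpace ℝ (Fin 3))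
    (x : UnitAddTorus (Fin 3)) :
    convect v (⇑(stokesMode (Pi.single (2 : Fin 3) (1 : ℤ)) a false)) x =
      (2 * Real.pi * v x 2) • stokesMode (Pi.single (2 : Fin 3) (1 : ℤ)) a true x := by
  rw [Torus.convect, gpForce_fderiv_stokesMode_sin]

/-- `∂₃ S = 2π • C` pointwise. -/
theorem partialDeriv_two_sinMode (x : UnitAddTorus (Fin 3)) :
    partialDeriv (2 : Fin 3) (⇑(stokesMode (Pi.single (2 : Fin 3) (1 : ℤ)) a false)) x =
      (2 * Real.pi) • stokesMode (Pi.single (2 : Fin 3) (1 : ℤ)) a true x := by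
  rw [AcdcStrain.partialDeriv_stokesMode_sin, stokesMode_apply]
  simp [smul_smul]

/-- `∂ⱼ S` has size at most `2π‖a‖`. -/
theorem norm_partialDeriv_sinMode_le (j : Fin 3) (x : UnitAddTorus (Fin 3)) :
    ‖partialDeriv j (⇑(stokesMode (Pi.single (2 : Fin 3) (1 : ℤ)) a false)) x‖ ≤
      2 * Real.pi * ‖a‖ := by
  have h1 : ‖UnitAddTorus.mFourier (Pi.single (2 : Fin 3) (1 : ℤ)) x‖ = 1 := by
    simp [UnitAddTorus.mFourier]
  have hre : |(UnitAddTorus.mFourier (Pi.single (2 : Fin 3) (1 : ℤ)) x).re| ≤ 1 := by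
    simpa [h1] using Complex.abs_re_le_norm (UnitAddTorus.mFourier (Pi.single (2 : Fin 3) (1 : ℤ)) x)
  have hk : |((Pi.single (2 : Fin 3) (1 : ℤ) : Fin 3 → ℤ) j : ℝ)| ≤ 1 := by
    fin_cases j <;> simp
  rw [AcdcStrain.partialDeriv_stokesMode_sin, norm_smul, Real.norm_eq_abs]
  have : |2 * Real.pi * ((Pi.single (2 : Fin 3) (1 : ℤ) : Fin 3 → ℤ) j : ℝ) *
      (UnitAddTorus.mFourier (Pi.single (2 : Fin 3) (1 : ℤ)) x).re| ≤ 2 * Real.pi := by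
    rw [abs_mul, abs_mul, abs_of_pos (by positivity : (0 : ℝ) < 2 * Real.pi)]
    calc 2 * Real.pi * |((Pi.single (2 : Fin 3) (1 : ℤ) : Fin 3 → ℤ) j : ℝ)| *
          |(UnitAddTorus.mFourier (Pi.single (2 : Fin 3) (1 : ℤ)) x).re|
        ≤ 2 * Real.pi * 1 * 1 := by gcongr
      _ = 2 * Real.pi := by ring
  exact mul_le_mul_of_nonneg_right this (norm_nonneg _)

/-- The Laplacian of the axial modes: `Δ(stokesMode e₃ a c) = -4π² • stokesMode e₃ a c`. -/
theorem laplacian_axialMode (c : Bool) (x : UnitAddTorus (Fin 3)) :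
    laplacian (⇑(stokesMode (Pi.single (2 : Fin 3) (1 : ℤ)) a c)) x =
      (-(4 * Real.pi ^ 2)) • stokesMode (Pi.single (2 : Fin 3) (1 : ℤ)) a c x := by
  rw [laplacian_stokesMode, stokesEigenvalue_axial]

end Shear



end Summit.AnomalousDissipation.AnomalousDissipation.Theorems.NewtonRealisation.Negative

end
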